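import Summits.Ventures.PackingBounds.Energy.FivePointQuartic
import Summits.Ventures.PackingBounds.Energy.FivePointQuarticGramMargin
import Summits.Ventures.PackingBounds.Energy.ThreePointEnergyDeficit
import Summits.Ventures.PackingBounds.Energy.FivePointBipyramidRigidity
import HarnessLib

/-!
# Five points on `S²`, potential `(1+⟪x,y⟫)⁴`: every minimiser is a triangular bipyramid (rigidity from the SOS face)

Framing: lottery ticket; floor = certified bounds/negative ranges. Venture `PackingBounds`, cell
`pub-packcert`, energy family E3PT (pub-packcert-energy gen 12).

First rigidity theorem for a certificate WITHOUT a Hermite-minorant step (`p = f = (1+t)^4`):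
if five unit vectors `C ⊂ ℝ³` attain `Σ_{x≠y} (1+⟪x,y⟫)⁴ = 99/8`, then by the deficit identity
(`ThreePointDeficit.energy_sub_bound_eq`) the slack of the three-point inequality vanishes at every ordered
triple of distinct points; the slack dominates the Gram form of the SOS term with multiplier `1`
(`rexp_eqQ4`), which is positive definite with margin `1/2000` (`quad_1_marginQ4`), so the face polynomial
`t(t+1)(t+1/2)` vanishes at every inner product `t = ⟪y,z⟫`: all inner products lie in `{0, -1, -1/2}`;
`Σ x = 0` from `a₁ > 0`; hence `C` is a triangular bipyramid (`Bipyramid5.rigid`).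
-/

noncomputable section

open Finset
open scoped RealInnerProductSpace

namespace Summit.Ventures.PackingBounds.Energy.FivePointQuartic

open Literature.Geometry.DiscreteGeometry Literature.Geometry.DiscreteGeometry.BachocVallentin
open Literature.Analysis.SpecialFunctions

/-- The two-point multiplier is strictly positive. -/
theorem a1_posQ4 : 0 < a1KQ4 := by unfold a1KQ4; norm_num

/-- **Rigidity of the `(1+t)⁴`-energy ground state of five points.** If five unit vectors of `ℝ³` attain
`Σ_{x≠y} (1+⟪x,y⟫)⁴ = 99/8`, then all inner products of distinct points lie in `{-1, 0, -1/2}`, `Σ x = 0`,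
and the configuration is a triangular bipyramid. -/
theorem ck4_five_points_rigid (C : Finset (EuclideanSpace ℝ (Fin 3))) (hC : ∀ x ∈ C, ‖x‖ = 1)
    (h5 : C.card = 5)
    (hmin : ∑ x ∈ C, ∑ y ∈ C.erase x, (1 + inner ℝ x y) ^ 4 = 99 / 8) :
    (∀ x ∈ C, ∀ y ∈ C, x ≠ y → inner ℝ x y = -1 ∨ inner ℝ x y = 0 ∨ inner ℝ x y = -1 / 2)
    ∧ (∑ x ∈ C, x = 0)
    ∧ ∃ p ∈ C, -p ∈ C ∧ (∀ z ∈ C, z ≠ p → z ≠ -p → inner ℝ z p = 0)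
        ∧ (∀ z ∈ C, ∀ w ∈ C, z ≠ p → z ≠ -p → w ≠ p → w ≠ -p → z ≠ w → inner ℝ z w = -1 / 2) := by
  classical
  have hA := pairSum_gegenbauer_comb_nonneg (n := 3) (by norm_num) 1 acoKQ4 aco_nonnegQ4 C hC
  have hF := tripleSum_threePointF3_nonneg 4 4 dcoKQ4 dco_nonnegQ4 gwKQ4 C hC
  have hcard : (C.card : ℝ) = 5 := by exact_mod_cast h5
  have hAeval : ∀ w : ℝ, (∑ k ∈ range (1 + 1), acoKQ4 k * gegenbauerSum ((((3 : ℕ) : ℝ) - 2) / 2) k w)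
      = a1KQ4 * w := by
    intro w
    have h0 : acoKQ4 0 = 0 := rfl
    have h1 : acoKQ4 1 = a1KQ4 := rfl
    simp only [Finset.sum_range_succ, Finset.sum_range_zero, h0, h1, gegenbauerSum_one, gegenbauerSum_zero]
    push_cast
    ring
  have hineq : ∀ u v t : ℝ, -1 ≤ u → u < 1 → -1 ≤ v → v < 1 → -1 ≤ t → t < 1 →
      0 ≤ 1 + 2 * u * v * t - u ^ 2 - v ^ 2 - t ^ 2 →
      c0KQ4 + ((C.card : ℝ) - 2) * threePointF3 4 4 dcoKQ4 gwKQ4 u v t + threePointF3 4 4 dcoKQ4 gwKQ4 u u 1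
        + threePointF3 4 4 dcoKQ4 gwKQ4 v v 1 + threePointF3 4 4 dcoKQ4 gwKQ4 t t 1
        + ((fun w => ∑ k ∈ range (1 + 1), acoKQ4 k * gegenbauerSum ((((3 : ℕ) : ℝ) - 2) / 2) k w) u
          + (fun w => ∑ k ∈ range (1 + 1), acoKQ4 k * gegenbauerSum ((((3 : ℕ) : ℝ) - 2) / 2) k w) v
          + (fun w => ∑ k ∈ range (1 + 1), acoKQ4 k * gegenbauerSum ((((3 : ℕ) : ℝ) - 2) / 2) k w) t) / 3
        ≤ (pminKQ4 u + pminKQ4 v + pminKQ4 t) / 3 := by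
    intro u v t hu1 hu2 hv1 hv2 ht1 ht2 hdet
    simp only [hAeval, hcard, threePointF3_eqQ4]
    have h1 := slack_nonnegQ4 u v t hu1 hu2.le hv1 hv2.le ht1 ht2.le hdet
    linarith
  -- the energy in terms of `pminKQ4`
  have hEp : ∑ x ∈ C, ∑ y ∈ C.erase x, pminKQ4 (inner ℝ x y) = 99 / 8 := by
    rw [← hmin]
    refine Finset.sum_congr rfl fun x _ => Finset.sum_congr rfl fun y _ => ?_
    simp only [pminKQ4]; ring
  have hsharp : ∑ x ∈ C, ∑ y ∈ C.erase x, pminKQ4 (inner ℝ x y)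
      = (C.card : ℝ) * (((C.card : ℝ) - 1) * c0KQ4 - threePointF3 4 4 dcoKQ4 gwKQ4 1 1 1
        - (fun w => ∑ k ∈ range (1 + 1), acoKQ4 k * gegenbauerSum ((((3 : ℕ) : ℝ) - 2) / 2) k w) 1) := by
    simp only [hAeval, hcard, threePointF3_eqQ4]
    rw [hEp, ← bound_eqQ4]
  obtain ⟨hA0, hF0⟩ := ThreePointDeficit.pairSum_eq_zero_of_sharp C hC (by omega) pminKQ4 _ _ c0KQ4 hA hF
    (threePointF3_swap12 4 4 dcoKQ4 gwKQ4) (threePointF3_swap23 4 4 dcoKQ4 gwKQ4) hineq hsharp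
  -- the triple-slack sum vanishes
  have hid := ThreePointDeficit.energy_sub_bound_eq C hC (by omega) pminKQ4
    (fun w => ∑ k ∈ range (1 + 1), acoKQ4 k * gegenbauerSum ((((3 : ℕ) : ℝ) - 2) / 2) k w)
    (threePointF3 4 4 dcoKQ4 gwKQ4) c0KQ4
    (threePointF3_swap12 4 4 dcoKQ4 gwKQ4) (threePointF3_swap23 4 4 dcoKQ4 gwKQ4)
  rw [hsharp, sub_self, hA0, hF0, add_zero, add_zero] at hid
  -- every term of the triple sum is ≥ 0
  have hrange : ∀ x ∈ C, ∀ y ∈ C, x ≠ y → -1 ≤ inner ℝ x y ∧ inner ℝ x y < 1 := by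
    intro x hx y hy hxy
    refine ⟨neg_one_le_real_inner_of_norm_eq_one (hC x hx) (hC y hy),
      lt_of_le_of_ne (real_inner_le_one_of_norm_eq_one (hC x hx) (hC y hy)) ?_⟩
    intro h1
    exact hxy ((inner_eq_one_iff_of_norm_eq_one (𝕜 := ℝ) (hC x hx) (hC y hy)).1 h1)
  set T : EuclideanSpace ℝ (Fin 3) → EuclideanSpace ℝ (Fin 3) → EuclideanSpace ℝ (Fin 3) → ℝ :=
    fun x y z => ((pminKQ4 (inner ℝ x y) + pminKQ4 (inner ℝ x z) + pminKQ4 (inner ℝ y z))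
        - (3 * c0KQ4 + 3 * (((C.card : ℝ) - 2) * threePointF3 4 4 dcoKQ4 gwKQ4 (inner ℝ x y) (inner ℝ x z) (inner ℝ y z))
          + 3 * (threePointF3 4 4 dcoKQ4 gwKQ4 (inner ℝ x y) (inner ℝ x y) 1
            + threePointF3 4 4 dcoKQ4 gwKQ4 (inner ℝ x z) (inner ℝ x z) 1
            + threePointF3 4 4 dcoKQ4 gwKQ4 (inner ℝ y z) (inner ℝ y z) 1)
          + ((fun w => ∑ k ∈ range (1 + 1), acoKQ4 k * gegenbauerSum ((((3 : ℕ) : ℝ) - 2) / 2) k w) (inner ℝ x y)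
            + (fun w => ∑ k ∈ range (1 + 1), acoKQ4 k * gegenbauerSum ((((3 : ℕ) : ℝ) - 2) / 2) k w) (inner ℝ x z)
            + (fun w => ∑ k ∈ range (1 + 1), acoKQ4 k * gegenbauerSum ((((3 : ℕ) : ℝ) - 2) / 2) k w) (inner ℝ y z))))
    with hTdef
  have hTnn : ∀ x ∈ C, ∀ y ∈ C.erase x, ∀ z ∈ (C.erase x).erase y, 0 ≤ T x y z := by
    intro x hx y hy z hz
    have hyC : y ∈ C := Finset.mem_of_mem_erase hy
    have hxy : x ≠ y := fun h => (Finset.ne_of_mem_erase hy) h.symm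
    have hz1 : z ∈ C.erase x := Finset.mem_of_mem_erase hz
    have hzC : z ∈ C := Finset.mem_of_mem_erase hz1
    have hzy : z ≠ y := Finset.ne_of_mem_erase hz
    have hzx : z ≠ x := Finset.ne_of_mem_erase hz1
    obtain ⟨lo1, hi1⟩ := hrange x hx y hyC hxy
    obtain ⟨lo2, hi2⟩ := hrange x hx z hzC hzx.symm
    obtain ⟨lo3, hi3⟩ := hrange y hyC z hzC hzy.symm
    have h0 := hineq _ _ _ lo1 hi1 lo2 hi2 lo3 hi3
      (BachocVallentin.gram3_nonneg x y z (hC x hx) (hC y hyC) (hC z hzC))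
    simp only [hTdef]
    linarith
  have hSum0 : ∑ x ∈ C, ∑ y ∈ C.erase x, ∑ z ∈ (C.erase x).erase y, T x y z = 0 := by
    have hpos : (0 : ℝ) < 1 / (3 * ((C.card : ℝ) - 2)) := by rw [hcard]; norm_num
    have h := hid.symm
    simp only [hTdef]
    rcases mul_eq_zero.1 h with h1 | h1
    · exact absurd h1 hpos.ne'
    · exact h1
  have hT0 : ∀ x ∈ C, ∀ y ∈ C.erase x, ∀ z ∈ (C.erase x).erase y, T x y z = 0 := by
    have h1 := (Finset.sum_eq_zero_iff_of_nonneg (fun x hx =>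
      Finset.sum_nonneg fun y hy => Finset.sum_nonneg fun z hz => hTnn x hx y hy z hz)).1 hSum0
    intro x hx
    have h2 := (Finset.sum_eq_zero_iff_of_nonneg (fun y hy =>
      Finset.sum_nonneg fun z hz => hTnn x hx y hy z hz)).1 (h1 x hx)
    intro y hy
    exact (Finset.sum_eq_zero_iff_of_nonneg (fun z hz => hTnn x hx y hy z hz)).1 (h2 y hy)
  -- value set: for distinct y, z pick a third point x and read off the face polynomial
  have hvals : ∀ y ∈ C, ∀ z ∈ C, y ≠ z → inner ℝ y z = -1 ∨ inner ℝ y z = 0 ∨ inner ℝ y z = -1 / 2 := by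
    intro y hy z hz hyz
    -- a third point
    have hcard3 : 0 < ((C.erase y).erase z).card := by
      rw [Finset.card_erase_of_mem (Finset.mem_erase.2 ⟨fun h => hyz h.symm, hz⟩),
        Finset.card_erase_of_mem hy, h5]; norm_num
    obtain ⟨x, hx⟩ := Finset.card_pos.1 hcard3
    have hx1 : x ∈ C.erase y := Finset.mem_of_mem_erase hx
    have hxC : x ∈ C := Finset.mem_of_mem_erase hx1
    have hxz : x ≠ z := Finset.ne_of_mem_erase hx
    have hxy : x ≠ y := Finset.ne_of_mem_erase hx1
    have hy' : y ∈ C.erase x := Finset.mem_erase.2 ⟨fun h => hxy h.symm, hy⟩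
    have hz' : z ∈ (C.erase x).erase y := Finset.mem_erase.2 ⟨fun h => hyz h.symm, Finset.mem_erase.2 ⟨fun h => hxz h.symm, hz⟩⟩
    have hT := hT0 x hxC y hy' z hz'
    simp only [hTdef, hAeval, hcard, threePointF3_eqQ4] at hT
    obtain ⟨lo1, hi1⟩ := hrange x hxC y hy hxy
    obtain ⟨lo2, hi2⟩ := hrange x hxC z hz hxz
    obtain ⟨lo3, hi3⟩ := hrange y hy z hz hyz
    have hdet := BachocVallentin.gram3_nonneg x y z (hC x hxC) (hC y hy) (hC z hz)
    set u := inner ℝ x y with hu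
    set v := inner ℝ x z with hv
    set t := inner ℝ y z with ht
    have mu1 : 0 ≤ 1 - u ^ 2 := by nlinarith
    have mv1 : 0 ≤ 1 - v ^ 2 := by nlinarith
    have mt1 : 0 ≤ 1 - t ^ 2 := by nlinarith
    have hre := rexp_eqQ4 u v t
    have g0 := quad_1_nonnegQ4 (wv_1Q4 u v t)
    have g1 := mul_nonneg mu1 (quad_g1_nonnegQ4 (wv_g1Q4 u v t))
    have g2 := mul_nonneg mv1 (quad_g2_nonnegQ4 (wv_g2Q4 u v t))
    have g3 := mul_nonneg mt1 (quad_g3_nonnegQ4 (wv_g3Q4 u v t))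
    have g4 := mul_nonneg (add_nonneg (add_nonneg (mul_nonneg mu1 mv1) (mul_nonneg mu1 mt1)) (mul_nonneg mv1 mt1))
      (quad_s2_nonnegQ4 (wv_s2Q4 u v t))
    have g5 := mul_nonneg hdet (quad_s4_nonnegQ4 (wv_s4Q4 u v t))
    have hq0 : quad_1Q4 (wv_1Q4 u v t) = 0 := by
      apply le_antisymm _ g0
      linarith [hT, hre, g1, g2, g3, g4, g5]
    rcases t_of_quad_wv_eq_zeroQ4 u v t hq0 with h | h | h
    · right; left; exact h
    · left; exact h
    · right; right; exact h
  -- balanced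
  have hfun : (fun w => ∑ k ∈ range (1 + 1), acoKQ4 k * gegenbauerSum ((((3 : ℕ) : ℝ) - 2) / 2) k w)
      = fun t => a1KQ4 * t := funext hAeval
  rw [hfun] at hA0
  have hsum0 : ∑ x ∈ C, x = 0 := ThreePointDeficit.sum_eq_zero_of_sharp C a1KQ4 a1_posQ4 hA0
  exact ⟨hvals, hsum0, Bipyramid5.rigid C hC h5 hsum0 hvals⟩

end Summit.Ventures.PackingBounds.Energy.FivePointQuartic
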